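import Summits.BirchSwinnertonDyer.BirchSwinnertonDyer.Theorems.GenusKolyvaginAtTwoGenusPrimitiveSupplyAtTwoTwistingPrimeDepthEntangledLocal
import Summits.BirchSwinnertonDyer.BirchSwinnertonDyer.Theorems.GenusKolyvaginAtTwoGenusPrimitiveSupplyAtTwoTwistSelmerStrictInherit
import Summits.BirchSwinnertonDyer.BirchSwinnertonDyer.Theorems.GenusKolyvaginAtTwoGenusPrimitiveSupplyAtTwoTwistingPrimeDepthOne
import HarnessLib

/-!
# Route `GenusKolyvaginAtTwo`, crux #2 `GenusPrimitiveSupplyAtTwo` (stmt-BirchSwinnertonDyer-22136):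
# ENTANGLED CAPSTONES — for an entangled row-1 twin the depth-`2` SUPPLY fails at EVERY depth-`2` Kolyvagin prime; the point
# condition of g8's habitat capstone (p623549) is NECESSARY

Width seat `bsd-line-gk2-p4` g9 (cell `bsd-f1-sign2`), thirteenth file of the twisting-prime series (crux workfile
`Lines/genus-supply-depth-class.md` §2). THEOREMS ONLY (no definition, no named fact, no `sorry`); helper
`--supports stmt-BirchSwinnertonDyer-22136`; no item is closed; BSD is not proved by any of this.

Composition of `…TwistingPrimeDepthEntangledLocal` §32 (entangled classes are strict at every depth-`M` Kolyvagin prime) with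
`GenusKolyTwistLocal.two_dvd_natCard_selmerGroup_twin_of_le_strictLocalKer` (`…TwistSelmerStrictInherit` §29: a strict twin with
`#Sel₂ = 2` has an even genus twist with EVEN `#Sel₂`):

* `two_dvd_natCard_selmerGroup_evenTwist_of_entangled` (class level: every Selmer class of the twin dies on `Γ_{ℚ(E[2^M])}` —
  the negation of hypothesis `hS'` of g8's `exists_kolyvaginPrime_pow_genusPair_selmer_of_cor34i`);
* `forall_selmer_torsionFixing_pow_h1Eval_eq_zero_of_half_fixed` (point-level reading: `#Sel₂(Wd) = 2`, `P ∉ 2Wd(ℚ)` with a half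
  fixed by `Γ_{ℚ(E[2^M])}` ⟹ all Selmer classes die there; `Sel₂(Wd) = {0, κ(P)}`);
* `two_dvd_natCard_selmerGroup_evenTwist_of_half_fixed` (point level — the converse of p623549's point condition).

At every prime `ℓ ≡ 7 (8)`, `ℓ ≡ −1 (mod` odd `p ∣ N_{Wd})`, `ℓ ∤ N_W`, with `FrobEqFrobInfty W K (2^M) ℓ` — in particular at every
prime the depth-`M` supply could return — every elliptic model of the even genus twist `Wd^{(−ℓ)}` has even `#Sel₂`, never `1`.
UNCONDITIONAL. Net for the line (row 1, `M = 2`): «∃ depth-2 Kolyvagin ℓ with `Sel₂`-trivial even genus twist» ⟺ «the twin's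
generator is not halvable over `ℚ(E[4])`» — ⟸ is p623549 (modulo Cor. 3.4 (i) DOWN = PT + Tate χ by gk2-p5 p624297), ⟹ is this
file; the depth-`2` road to the auxiliary-field form of U (p615396) is closed exactly on the entangled cells (DES13: 2/510), where
g7's depth-ONE supply remains. EXACT-INDEX₂ is untouched.

References: [MazurRubin2010] Def. 3.1, Prop. 3.3, Cor. 3.4 (i), Lemma 3.5, Remark 2.4; [GrossLMS1991] §3, §9 Prop. 9.6;
[SilvermanAEC2009] VIII.2, X.4; [LawsonWuthrich2016] Lemma 6, Thm. 1.
-/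

set_option linter.dupNamespace false -- tree convention: `Summit.BirchSwinnertonDyer.BirchSwinnertonDyer.Theorems` (summit = sub-problem)
set_option autoImplicit false

noncomputable section

open scoped Classical Pointwise

namespace Summit.BirchSwinnertonDyer.BirchSwinnertonDyer.Theorems.GenusKolyTwistingPrime

open WeierstrassCurve NumberField IsDedekindDomain Field
open Literature.NumberTheory.GaloisRepresentations Literature.NumberTheory.EllipticCurves
open Literature.NumberTheory

/-! ## §33 ENTANGLED CAPSTONES: the point condition of the depth-`2` supply is NECESSARY -/

section Entangled

variable (W : WeierstrassCurve ℚ) [W.IsElliptic] {K : Type} [Field K] [NumberField K]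

/-- **ENTANGLED CAPSTONE (class level) — the converse of g8's `exists_kolyvaginPrime_pow_genusPair_selmer_of_cor34i` on its
twin-side hypothesis.** Let `W/ℚ` be globally minimal elliptic with `Δ_W < 0`, `Wd` a globally minimal model of a twist `W^{(d)}`
(`d ≠ 0`) with `#Sel₂(Wd) = 2` (the LEVEL LAW's twin `A`), `M ≥ 1`. ASSUME every `2`-Selmer class of `Wd` DIES on `Γ_{ℚ(E[2^M])}`
(«entangled»: at `M = 2`, by the Kummer reading, the generator of `A(ℚ)/2` is halvable over `ℚ(E[4])` — MEMO-es §13's exception,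
2/510 in DES13). THEN at EVERY prime `ℓ ≡ 7 (mod 8)` with `ℓ ≡ −1 (mod p)` for the odd `p ∣ N_{Wd}` (so that `ℚ(√−ℓ)` is a prime
Heegner field for `N_{Wd}` with `2` split), `ℓ ∤ N_W`, and `FrobEqFrobInfty W K (2^M) ℓ` — in particular at every prime the
depth-`M` supply COULD return (it returns `ℓ ≡ 7 (8)`, `8 N_W N_{Wd} ∣ ℓ + 1`, depth `M`) — EVERY elliptic model `W₂` of the even
genus twist `Wd^{(−ℓ)}` has `2 ∣ #Sel₂(W₂)`, hence `#Sel₂(W₂) ≠ 1`: the conclusion «`#Sel₂ = 1`» of the supply fails at every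
candidate prime. UNCONDITIONAL (§32 + `GenusKolyTwistLocal.two_dvd_natCard_selmerGroup_twin_of_le_strictLocalKer`; no print
fact, no Poitou–Tate). Net, on row 1: «∃ depth-2 Kolyvagin ℓ with `Sel₂`-trivial even genus twist» ⟺ «non-entanglement»
(⟸: p623549, modulo Cor. 3.4 (i) DOWN; ⟹: this theorem). BSD is not proved by this.
[cite: MazurRubin2010, Cor. 3.4 (i), Prop. 3.3, Lemma 3.5] [cite: GrossLMS1991, §3 (3.1)–(3.3), §9 Prop. 9.6]
[cite: LawsonWuthrich2016, Lemma 6 and Thm. 1] -/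
theorem two_dvd_natCard_selmerGroup_evenTwist_of_entangled (hΔ : W.Δ < 0)
    {d : ℚ} (hd : d ≠ 0) {Wd : WeierstrassCurve ℚ} [Wd.IsElliptic] [Wd.IsGloballyMinimal] {C : VariableChange ℚ}
    (hWd : C • W.quadraticTwist d = Wd) (h2 : Nat.card (Wd.selmerGroup 2) = 2) {M : ℕ} (hM : 1 ≤ M)
    (hent : ∀ c ∈ Wd.selmerGroup 2, ∀ h ∈ torsionFixing W ((2 ^ M : ℕ) : ℤ), h1Eval Wd (2 : ℤ) c h = 0)
    {ℓ : ℕ} [Fact ℓ.Prime] (hℓ8 : ℓ % 8 = 7) (hℓN : ¬ ℓ ∣ W.conductorNorm ℤ)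
    (hℓNd : ∀ p : ℕ, p.Prime → p ∣ Wd.conductorNorm ℤ → p ≠ 2 → (ℓ : ZMod p) = -1)
    (hFrob : FrobEqFrobInfty W K (2 ^ M) ℓ)
    (W₂ : WeierstrassCurve ℚ) [W₂.IsElliptic] (hW₂ : ∃ C₂ : VariableChange ℚ, C₂ • Wd.quadraticTwist (-(ℓ : ℚ)) = W₂) :
    2 ∣ Nat.card (W₂.selmerGroup 2) ∧ Nat.card (W₂.selmerGroup 2) ≠ 1 := by
  have hℓ : ℓ.Prime := Fact.out
  have hℓ2 : ℓ ≠ 2 := by omega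
  have hΔd : Wd.Δ < 0 := GenusKolyTwistLocal.Δ_neg_of_smul_quadraticTwist W hd hΔ hWd
  -- strictness of `Sel₂(Wd)` at `ℓ` (§32)
  have hs : Wd.selmerGroup 2 ≤ MazurRubin2010.strictLocalKer Wd ℚ_[ℓ] 2 :=
    selmerGroup_le_strictLocalKer_of_forall_torsionFixing_pow_h1Eval_eq_zero W hd hWd hΔd hM hℓ2 hℓN hFrob hent
  -- the prime Heegner field `ℚ(√−ℓ)` of `Wd`
  obtain ⟨-, -, K₂, _, _, hK₂, hd₂, -, -, hH₂, h2K₂, -, -⟩ :=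
    GenusKolyTwin.exists_heegnerField_of_prime Wd hℓ hℓ8 hℓNd
  have hW₂' : ∃ C₂ : VariableChange ℚ, C₂ • Wd.quadraticTwist (discr K₂ : ℚ) = W₂ := by
    rw [hd₂]; push_cast; exact hW₂
  exact GenusKolyTwistLocal.two_dvd_natCard_selmerGroup_twin_of_le_strictLocalKer Wd hΔd hK₂ hH₂ h2K₂ hd₂ h2 W₂ hW₂' hs

omit [W.IsElliptic] in
/-- **All `2`-Selmer classes of a rank-one twin die where its generator's half is fixed** (point-level reading of «entangled»):
`Wd` any elliptic model of `W^{(d)}` (`d ≠ 0`), `#Sel₂(Wd) = 2`, `P ∈ Wd(ℚ)` with a half `Q` (`2Q = P`) such that NO translate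
`Q − T`, `T ∈ Wd[2]`, is `Γ_ℚ`-fixed (`P ∉ 2Wd(ℚ)`: the Kummer class `κ(P)` is non-zero, `kummerClassTorsion_eq_zero_iff`), and
`Q` FIXED by every element of `Γ_{ℚ(E[2^M])}`. Then `Sel₂(Wd) = {0, κ(P)}` and `[c, h] = hQ − Q = 0` for every Selmer class `c`
and every `h ∈ Γ_{ℚ(E[2^M])}`. [cite: SilvermanAEC2009, VIII.2 (Kummer pairing), X.4.2] [cite: MazurRubin2010, Remark 2.4] -/
theorem forall_selmer_torsionFixing_pow_h1Eval_eq_zero_of_half_fixed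
    {d : ℚ} (hd : d ≠ 0) {Wd : WeierstrassCurve ℚ} [Wd.IsElliptic] {C : VariableChange ℚ}
    (hWd : C • W.quadraticTwist d = Wd) (h2 : Nat.card (Wd.selmerGroup 2) = 2) {M : ℕ} (hM : 1 ≤ M)
    (P : Wd.toAffine.Point) (Q : geomPoints Wd) (hQ : (2 : ℤ) • Q = toGeomPoints Wd P)
    (hP : ∀ T ∈ geomTorsion Wd (2 : ℤ), Q - T ∉ MulAction.fixedPoints (absoluteGaloisGroup ℚ) (geomPoints Wd))
    (hfix : ∀ h ∈ torsionFixing W ((2 ^ M : ℕ) : ℤ), h • Q = Q) :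
    ∀ c ∈ Wd.selmerGroup 2, ∀ h ∈ torsionFixing W ((2 ^ M : ℕ) : ℤ), h1Eval Wd (2 : ℤ) c h = 0 := by
  classical
  have hdiv := Wd.zsmul_geomPoints_surjective_of_charZero (n := (2 : ℤ)) two_ne_zero
  obtain ⟨ψ, hψ⟩ := exists_equivariant_addEquiv_geomTorsion_two_of_twist W hd hWd
  have hTd : torsionFixing W (2 : ℤ) ≤ torsionFixing Wd (2 : ℤ) :=
    torsionFixing_le_of_equivariant_addEquiv Wd W (2 : ℤ) ψ hψ
  have h2M : (2 : ℤ) ∣ ((2 ^ M : ℕ) : ℤ) := by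
    rw [Nat.cast_pow, Nat.cast_ofNat]; exact dvd_pow_self 2 (by omega : M ≠ 0)
  have hTn : torsionFixing W ((2 ^ M : ℕ) : ℤ) ≤ torsionFixing W (2 : ℤ) :=
    KolyvaginLowerBoundAtTwo.torsionFixing_le_of_dvd W h2M
  -- the Kummer class `κ(P) ∈ Sel₂(Wd)`, non-zero
  have hQfix : (2 : ℤ) • Q ∈ MulAction.fixedPoints (absoluteGaloisGroup ℚ) (geomPoints Wd) := by
    rw [hQ]; exact WeierstrassCurve.toGeomPoints_mem_fixedPoints Wd P
  set κ := WeierstrassCurve.kummerMapTorsion Wd (2 : ℤ) hdiv P with hκdef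
  have hκeq : κ = Wd.kummerClassTorsion (2 : ℤ) Q hQfix := by
    rw [hκdef, WeierstrassCurve.kummerMapTorsion_apply, WeierstrassCurve.kummerMapTorsionFun_eq Wd (2 : ℤ) hdiv P Q hQ]
  have hκS : κ ∈ Wd.selmerGroup 2 :=
    (mem_selmerGroup_iff _ _ _).mpr ⟨fun _ ↦ WeierstrassCurve.kummerMapTorsion_mem_selmerLocalKer _ _ _ _ P,
      fun _ ↦ WeierstrassCurve.kummerMapTorsion_mem_selmerLocalKer _ _ _ _ P⟩
  have hκ0 : κ ≠ 0 := by
    rw [hκeq]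
    intro h0
    obtain ⟨T, hT, hfixT⟩ := (WeierstrassCurve.kummerClassTorsion_eq_zero_iff Wd (2 : ℤ) Q hQfix).mp h0
    exact hP T hT hfixT
  -- `[κ(P), h] = hQ − Q = 0` on `Γ_{ℚ(E[2^M])}`
  have hκeval : ∀ h ∈ torsionFixing W ((2 ^ M : ℕ) : ℤ), h1Eval Wd (2 : ℤ) κ h = 0 := by
    intro h hh
    have hc := coe_h1Eval_kummerClassTorsion Wd (2 : ℤ) Q hQfix (hTd (hTn hh))
    rw [hfix h hh, sub_self] at hc
    rw [hκeq]
    exact ZeroMemClass.coe_eq_zero.mp hc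
  -- `Sel₂(Wd) = {0, κ}` since `#Sel₂(Wd) = 2`
  intro c hc h hh
  by_cases hc0 : c = 0
  · rw [hc0]; exact h1Eval_zero Wd _ (hTd (hTn hh))
  by_cases hcκ : c = κ
  · rw [hcκ]; exact hκeval h hh
  exfalso
  haveI : Finite (Wd.selmerGroup 2) := Nat.finite_of_card_ne_zero (by rw [h2]; norm_num)
  haveI : Fintype (Wd.selmerGroup 2) := Fintype.ofFinite _
  have h3 : 3 ≤ Nat.card (Wd.selmerGroup 2) := by
    have hsub : ({⟨0, zero_mem _⟩, ⟨κ, hκS⟩, ⟨c, hc⟩} : Finset (Wd.selmerGroup 2)).card = 3 := by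
      rw [Finset.card_insert_of_notMem, Finset.card_insert_of_notMem, Finset.card_singleton]
      · simp only [Finset.mem_singleton, Subtype.mk.injEq]
        exact fun h' ↦ hcκ h'.symm
      · simp only [Finset.mem_insert, Finset.mem_singleton, Subtype.mk.injEq, not_or]
        exact ⟨fun h' ↦ hκ0 h'.symm, fun h' ↦ hc0 h'.symm⟩
    rw [← hsub, Nat.card_eq_fintype_card]
    exact Finset.card_le_univ _
  omega

/-- **ENTANGLED CAPSTONE (point level) — the converse of g8's habitat capstone
`exists_kolyvaginPrime_depthTwo_genusPair_selmer_of_cor34i_of_half` (p623549) on its point condition.** `W/ℚ` globally minimal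
with `Δ_W < 0`, `Wd` a globally minimal model of `W^{(d)}` with `#Sel₂(Wd) = 2`, `P ∈ Wd(ℚ)` NOT in `2Wd(ℚ)` (no `Γ_ℚ`-fixed half)
with a half `Q` FIXED by `Γ_{ℚ(E[2^M])}` — «the twin's generator is halvable over `ℚ(E[2^M])`», ENTANGLED. THEN at every prime
`ℓ ≡ 7 (8)`, `ℓ ≡ −1 (mod` odd `p ∣ N_{Wd})`, `ℓ ∤ N_W`, with `FrobEqFrobInfty W K (2^M) ℓ`, every elliptic model of `Wd^{(−ℓ)}` has
EVEN `#Sel₂`, never `1`. At `M = 2`: for an entangled row-1 twin NO depth-`2` Kolyvagin prime carries a `Sel₂`-trivial even genus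
twist — the depth-`2` road to the auxiliary-field form of U (p615396) is CLOSED exactly on the entangled cells (where the
depth-ONE supply of g7, `exists_kolyvaginPrime_pow_one_genusPair_selmer_of_cor34i`, remains). Unconditional; BSD is not proved
by this. [cite: MazurRubin2010, Cor. 3.4 (i), Prop. 3.3, Lemma 3.5] [cite: SilvermanAEC2009, VIII.2 (Kummer pairing)]
[cite: LawsonWuthrich2016, Lemma 6 and Thm. 1] -/
theorem two_dvd_natCard_selmerGroup_evenTwist_of_half_fixed (hΔ : W.Δ < 0)
    {d : ℚ} (hd : d ≠ 0) {Wd : WeierstrassCurve ℚ} [Wd.IsElliptic] [Wd.IsGloballyMinimal] {C : VariableChange ℚ}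
    (hWd : C • W.quadraticTwist d = Wd) (h2 : Nat.card (Wd.selmerGroup 2) = 2) {M : ℕ} (hM : 1 ≤ M)
    (P : Wd.toAffine.Point) (Q : geomPoints Wd) (hQ : (2 : ℤ) • Q = toGeomPoints Wd P)
    (hP : ∀ T ∈ geomTorsion Wd (2 : ℤ), Q - T ∉ MulAction.fixedPoints (absoluteGaloisGroup ℚ) (geomPoints Wd))
    (hfix : ∀ h ∈ torsionFixing W ((2 ^ M : ℕ) : ℤ), h • Q = Q)
    {ℓ : ℕ} [Fact ℓ.Prime] (hℓ8 : ℓ % 8 = 7) (hℓN : ¬ ℓ ∣ W.conductorNorm ℤ)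
    (hℓNd : ∀ p : ℕ, p.Prime → p ∣ Wd.conductorNorm ℤ → p ≠ 2 → (ℓ : ZMod p) = -1)
    (hFrob : FrobEqFrobInfty W K (2 ^ M) ℓ)
    (W₂ : WeierstrassCurve ℚ) [W₂.IsElliptic] (hW₂ : ∃ C₂ : VariableChange ℚ, C₂ • Wd.quadraticTwist (-(ℓ : ℚ)) = W₂) :
    2 ∣ Nat.card (W₂.selmerGroup 2) ∧ Nat.card (W₂.selmerGroup 2) ≠ 1 :=
  two_dvd_natCard_selmerGroup_evenTwist_of_entangled W hΔ hd hWd h2 hM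
    (forall_selmer_torsionFixing_pow_h1Eval_eq_zero_of_half_fixed W hd hWd h2 hM P Q hQ hP hfix) hℓ8 hℓN hℓNd hFrob W₂ hW₂

end Entangled

end Summit.BirchSwinnertonDyer.BirchSwinnertonDyer.Theorems.GenusKolyTwistingPrime

end
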